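import Summits.ResolutionOfSingularities.ResolutionOfSingularities.Theorems.EquisingularLiftEquisingularLiftNatTowerInvDefs
import Summits.ResolutionOfSingularities.ResolutionOfSingularities.Theorems.EquisingularLiftEquisingularLiftNatSubchainSupplierInvKDefs
import Summits.ResolutionOfSingularities.ResolutionOfSingularities.Theorems.EquisingularLiftEquisingularLiftNatModelStepChain
import Summits.ResolutionOfSingularities.ResolutionOfSingularities.Theorems.EquisingularLiftEquisingularLiftNatExceptionalReducedModel
import Summits.ResolutionOfSingularities.ResolutionOfSingularities.Theorems.EquisingularLiftEquisingularLiftNatConeRoundCentre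
import Summits.ResolutionOfSingularities.ResolutionOfSingularities.Theorems.EquisingularLiftEquisingularLiftNatConeRoundTransport
import Summits.ResolutionOfSingularities.ResolutionOfSingularities.Theorems.EquisingularLiftEquisingularLiftNatRegularOfSpecialFibre
import Summits.ResolutionOfSingularities.ResolutionOfSingularities.Theorems.EquisingularLiftEquisingularLiftNatCarrierPairStrictTransformRegular
import Literature.AlgebraicGeometry.Resolution.ExceptionalDivisorRegularGlobal
import Literature.AlgebraicGeometry.Resolution.RegularQuotientIdeal
import Literature.AlgebraicGeometry.Resolution.BlowupsExistence
import Literature.AlgebraicGeometry.Resolution.NearPointsSigmaLocal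
import HarnessLib

/-!
# [OURS · L1 W4.5(b) · EL♮(3)] HSUB′(ReachTower₀/₁) — THE CURVE STEP OF THE TOWER DRIVER: `InvKC ⇒ Tower.Inv₁` on the tower seed
# (driver `hsub_reachTower_of_invariant` p549473 / `hsub_reachTower₁_of_invariant`, clause (curve); invariants …NatSubchainSupplierInvKDefs /
# …NatTowerInvDefs)

res-D-pv-029 g8 (HSUB′(ReachTower)₃ ASSEMBLY, res-L1-w45b-plan-1 NAMING 2026-08-27T16:17:51Z, RULING-5/6). OURS; NOT a statement of any
manuscript; AI-written, weaker than expert review. No `sorry`; standard axioms. DEF-FREE. `--supports stmt-ResolutionOfSingularities-20148 --as helper`.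

WHAT. `Tower.inv₁_of_invKC_curveStep`: at the end of the inner chain (`TCPlus.InvKC … W F₉ β₉ T₉ Z₉ K₉ b₉`, `Z₉` closed infinite,
`Z₉ ⊆ T₉ ⊄ Z₉`, the shadow off the curve dense in itself `K₉ ⊆ closure (K₉ ∖ Z₉)`, `υ' : F₁₀ → F₉` the blow-up of `𝓘⟨Z₉⟩`) the TOWER-STAGE
INVARIANT holds on the seed `(F₁₀, 𝟙, closure υ'⁻¹(T₉ ∖ Z₉), υ'⁻¹Z₉, closure υ'⁻¹(K₉ ∖ Z₉))` — modulo ONE named stand-in: the ruled-surface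
datum `Ruled` of the freshly created exceptional surface (hypothesis `hRuled`, the `Ruled`-root = this curve step; owner res-L1-w45b-stub-2 /
res-type-027, T-DIRLIFT / T-PROJDICT currency). Construction: the uncentred member `(X, σ, S, jG, tG, 𝓢, K)` of the invariant; the centre
`𝒞 := 𝓢 ⊔ K` — exact special fibre `Z₉` (i), `O`-flat (ii), regular (res-type-032's `Scheme.isRegular_subscheme_of_forall_over_closedPoint`
from (v)), off the generic point of `Y` (iv); `exists_isBlowup` and res-D-pv-029's `modelStep_chain` (p523633) give the next `Ch`-stage
`X₁₀ = Bl_𝒞 X` with its model square `j₁₀ : F₁₀ → X₁₀`; the EXCEPTIONAL SURFACE `𝓔₁₀ := 𝒞·𝒪_{X₁₀}`: (e-i) reduced exact trace `υ'⁻¹Z₉` by the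
model-square lemma `comap_comap_eq_vanishingIdeal_preimage_of_model` (…NatExceptionalReducedModel, quasi-regular frames of the regular `𝒞` from
Literature `exists_isQuasiRegular_span_eq_of_isRegularLocalRing_quotient`), (e-ii) locally principal (`IsBlowup.isEffectiveCartier`),
(e-iii) regular (Literature `IsBlowup.isRegular_subscheme_comap`), (e-iv) off the generic point of `Y` (under `σ`), (e-v) `hRuled`; the SHADOW
`𝒦₁₀ := strictTransformIdeal τ 𝒞 K` — the curve step IS a cone round with `𝓔 := 𝓢` (res-D-pv-051 `coneRound` p545368, clause (viii) of
`MemberKC` is its Cartier hypothesis): (k-i) res-D-pv-032's `isPrincipal_stalkIdeal_strictTransformIdeal` (p529806), (k-ii)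
`coneRound_shadow_comap` (p549332, cartesian model square by pullback pasting `isPullback_of_model_squares`), (k-iii)/(k-iv) along
`coneRound_centreIso`/`coneRound_flat`/`coneRound_isRegular` from (ii)/(v).

References: as named; [cite: GortzWedhorn2020, (13.19) and Prop. 13.91]; [cite: Liu2002, Thm. 8.1.19].
-/

set_option linter.dupNamespace false -- mandated namespace `Summit.<Summit>.<Problem>` of this single-conjunct summit
set_option linter.overlappingInstances false -- signatures carry `[IsDomain O] [IsDiscreteValuationRing O]`

noncomputable section

open CategoryTheory CategoryTheory.Limits AlgebraicGeometry TopologicalSpace Topology IsLocalRing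
open Literature.AlgebraicGeometry.Resolution
open AlgebraicGeometry.Scheme.IdealSheafData
open Summit.ResolutionOfSingularities.ResolutionOfSingularities.Theses.EquisingularLift.Split
open Summit.ResolutionOfSingularities.ResolutionOfSingularities.Cruxes.EquisingularLift.StrataSplit

namespace Summit.ResolutionOfSingularities.ResolutionOfSingularities.Cruxes.EquisingularLiftNat.Sections

/-! ## Model-square plumbing -/

/-- **The model squares of a step are cartesian over the step**: from the two model squares over `Spec θ` (before and after a
morphism `τ`) and the commuting square `j₂ ≫ τ = υ ≫ j`, the square `(j₂, υ, τ, j)` is a pullback (pasting; `Spec θ` is a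
monomorphism). [folklore] -/
theorem isPullback_of_model_squares {O k : Type} [CommRing O] [CommRing k] (θ : O →+* k) (hθ : Function.Surjective θ)
    {X X₂ F F₂ : Scheme.{0}} (r : X ⟶ Spec (.of O)) (τ : X₂ ⟶ X)
    (j : F ⟶ X) (t : F ⟶ Spec (.of k)) (hsq : IsPullback j t r (Spec.map (CommRingCat.ofHom θ)))
    (j₂ : F₂ ⟶ X₂) (t₂ : F₂ ⟶ Spec (.of k)) (hsq₂ : IsPullback j₂ t₂ (τ ≫ r) (Spec.map (CommRingCat.ofHom θ)))
    (υ : F₂ ⟶ F) (hcomm : j₂ ≫ τ = υ ≫ j) : IsPullback j₂ υ τ j := by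
  haveI : IsClosedImmersion (Spec.map (CommRingCat.ofHom θ)) := IsClosedImmersion.spec_of_surjective _ hθ
  have ht₂ : t₂ = υ ≫ t := by
    rw [← cancel_mono (Spec.map (CommRingCat.ofHom θ)), Category.assoc, ← hsq.w, ← Category.assoc, ← hcomm, Category.assoc,
      ← hsq₂.w]
  have houter : IsPullback (υ ≫ t) j₂ (Spec.map (CommRingCat.ofHom θ)) (τ ≫ r) := by
    rw [← ht₂]; exact hsq₂.flip
  exact (IsPullback.of_right houter hcomm.symm hsq.flip).flip

/-! ## The curve step -/

set_option maxHeartbeats 800000 in -- one large refine over a 20-clause invariant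
/-- **THE CURVE STEP of the tower driver: `InvKC ⇒ Tower.Inv₁` on the tower seed** (see the module docstring), modulo the named stand-in
`hRuled` (the ruled-surface datum of the freshly created exceptional surface, root = this curve step).
[cite: GortzWedhorn2020, (13.19) and Prop. 13.91] [cite: Liu2002, Thm. 8.1.19] [OURS · L1 W4.5b] clause (curve) of `hsub_reachTower_of_invariant`
/ `hsub_reachTower₁_of_invariant` toward `stub_elnat_coneTowerPointResolution`; NOT a statement of the manuscript. -/
theorem Tower.inv₁_of_invKC_curveStep (O : Type) [CommRing O] [IsDomain O] [IsDiscreteValuationRing O] (k : Type) [Field k]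
    (θ : O →+* k) (hθ : Function.Surjective θ)
    (P : Scheme.{0}) (q : P ⟶ Spec (.of O)) [IsProper q] (Y : Set P) (hYirr : IsIrreducible Y) (hYcl : IsClosed Y)
    (hPnoeth : IsLocallyNoetherian P) (hPreg : Scheme.IsRegular P)
    (Ch : ∀ X' : Scheme.{0}, (X' ⟶ P) → Set X' → Prop)
    (hChain : ∀ (X' : Scheme.{0}) (σ : X' ⟶ P) (S : Set X'), Ch X' σ S → Chain P Y X' σ S)
    (hStep : ∀ (X' X'' : Scheme.{0}) (σ' : X' ⟶ P) (S' : Set X') (C : X'.IdealSheafData) (τ : X'' ⟶ X'),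
      Ch X' σ' S' → IsBlowup τ C → Scheme.IsRegular C.subscheme → Flat (C.subschemeι ≫ σ' ≫ q) →
      σ' '' (C.support : Set X') ⊆ {x : P | ¬ IsGenericPoint x Y} →
      (C.support : Set X') ∩ (σ' ≫ q) ⁻¹' {IsLocalRing.closedPoint O} ⊆ S' →
      Ch X'' (τ ≫ σ') (closure (τ ⁻¹' (S' \ (C.support : Set X')))))
    (Ruled : Tower.RuledDatum P)
    {F₁ F₂ : Scheme.{0}} (W : Set F₁) (F₉ : Scheme.{0}) (β₉ : F₉ ⟶ F₂) (T₉ Z₉ K₉ : Set F₉) (b₉ : Bool) (hZ₉ : IsClosed Z₉)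
    (F₁₀ : Scheme.{0}) (υ' : F₁₀ ⟶ F₉)
    (hI : TCPlus.InvKC O k θ P q Y Ch W F₉ β₉ T₉ Z₉ K₉ b₉) (hZinf : Z₉.Infinite) (hKcl : IsClosed K₉)
    (hKdense : K₉ ⊆ closure (K₉ \ Z₉))
    (hZT : Z₉ ⊆ T₉) (hTZ : ¬ T₉ ⊆ Z₉) (hυ' : IsBlowup υ' (vanishingIdeal ⟨Z₉, hZ₉⟩))
    -- STAND-IN (owner res-L1-w45b-stub-2 / res-type-027): the ruled-surface datum of the new exceptional surface, root = this step
    (hRuled : ∀ (X : Scheme.{0}) (σ : X ⟶ P) (S : Set X) (jG : F₉ ⟶ X) (tG : F₉ ⟶ Spec (.of k)) (𝓢 K : X.IdealSheafData)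
        (X₁₀ : Scheme.{0}) (τ : X₁₀ ⟶ X) (j₁₀ : F₁₀ ⟶ X₁₀) (t₁₀ : F₁₀ ⟶ Spec (.of k)),
        Ch X σ S → IsIntegral X → IsLocallyNoetherian X → Scheme.IsRegular X → IsDominant (σ ≫ q) →
        IsPullback jG tG (σ ≫ q) (Spec.map (CommRingCat.ofHom θ)) → jG '' T₉ = S →
        (𝓢 ⊔ K).comap jG = vanishingIdeal ⟨Z₉, hZ₉⟩ → Flat ((𝓢 ⊔ K).subschemeι ≫ σ ≫ q) → Scheme.IsRegular (𝓢 ⊔ K).subscheme →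
        Scheme.IsRegular 𝓢.subscheme → IsBlowup τ (𝓢 ⊔ K) → IsPullback j₁₀ t₁₀ ((τ ≫ σ) ≫ q) (Spec.map (CommRingCat.ofHom θ)) →
        j₁₀ ≫ τ = υ' ≫ jG →
        Ruled F₉ Z₉ hZ₉ F₁₀ υ' F₁₀ (𝟙 F₁₀) (υ' ⁻¹' Z₉) X₁₀ (τ ≫ σ) j₁₀ ((𝓢 ⊔ K).comap τ)) :
    Tower.Inv₁ O k θ P q Y Ch Ruled F₉ Z₉ hZ₉ F₁₀ υ' F₁₀ (𝟙 F₁₀) (closure (υ' ⁻¹' (T₉ \ Z₉))) (υ' ⁻¹' Z₉)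
      (closure (υ' ⁻¹' (K₉ \ Z₉))) := by
  classical
  obtain ⟨hGint, hT₉cl, hT₉irr, -, hmem, -⟩ := hI
  obtain ⟨X, σ, S, jG, tG, 𝓢, K, hCh, hXint, hXnoeth, hXreg, hdom, hsq, hTS, hi, hii, hiii, hiiip, hiv, hv, -, hvii, hviii⟩ := hmem
  haveI := hGint
  haveI := hXint
  haveI := hXnoeth
  -- the closed carrier curve
  have hZcl : (⟨closure Z₉, isClosed_closure⟩ : Closeds F₉) = ⟨Z₉, hZ₉⟩ := Closeds.ext hZ₉.closure_eq
  have hCD : (𝓢 ⊔ K).comap jG = vanishingIdeal ⟨Z₉, hZ₉⟩ := by rw [← hZcl]; exact hi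
  have hKD : K.comap jG = vanishingIdeal (⟨closure K₉, isClosed_closure⟩ : Closeds F₉) := hvii
  -- properness of the stage
  obtain ⟨-, -, hσ⟩ := chain_isRegular P Y X σ S (hChain _ _ _ hCh) hPnoeth hPreg
  haveI := hσ
  haveI : IsProper (σ ≫ q) := inferInstance
  -- the model square: `jG` is a closed immersion onto the special fibre
  haveI : IsClosedImmersion (Spec.map (CommRingCat.ofHom θ)) := IsClosedImmersion.spec_of_surjective _ hθ
  haveI hjci : IsClosedImmersion jG := MorphismProperty.IsStableUnderBaseChange.of_isPullback hsq.flip inferInstance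
  have hjsp : ∀ z : F₉, (σ ≫ q) (jG z) = closedPoint O := fun z => by
    have h1 : jG z ∈ Set.range jG := ⟨z, rfl⟩
    rw [range_eq_preimage_of_isPullback hsq, range_specMap_of_surjective_of_field θ hθ] at h1
    exact h1
  -- the centre `𝒞 = 𝓢 ⊔ K` is regular: regular quotient stalks over the closed point + properness
  have hCreg_pt : ∀ x ∈ ((𝓢 ⊔ K).support : Set X), (σ ≫ q) x = closedPoint O →
      IsRegularLocalRing (X.presheaf.stalk x ⧸ stalkIdeal (𝓢 ⊔ K) x) := fun x hx hqx => (hv x hx hqx (by simp)).1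
  haveI : IsProper ((𝓢 ⊔ K).subschemeι ≫ σ ≫ q) := inferInstance
  have hCreg : Scheme.IsRegular (𝓢 ⊔ K).subscheme :=
    Scheme.isRegular_subscheme_of_forall_over_closedPoint (σ ≫ q) (𝓢 ⊔ K) fun x hx hqx => hCreg_pt x hx hqx
  -- support bookkeeping downstairs
  have hsuppZ : ((vanishingIdeal ⟨Z₉, hZ₉⟩ : F₉.IdealSheafData).support : Set F₉) = Z₉ := Scheme.IdealSheafData.coe_support_vanishingIdeal _
  have hDT : ((vanishingIdeal ⟨Z₉, hZ₉⟩ : F₉.IdealSheafData).support : Set F₉) ⊆ T₉ := by rw [hsuppZ]; exact hZT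
  have hTD : ¬ T₉ ⊆ ((vanishingIdeal ⟨Z₉, hZ₉⟩ : F₉.IdealSheafData).support : Set F₉) := by rw [hsuppZ]; exact hTZ
  -- blow up the centre and run the model step
  obtain ⟨X₂, τ, hτ⟩ := exists_isBlowup X (𝓢 ⊔ K)
  obtain ⟨hint₂, hnoeth₂, hreg₂, hdom₂, hF₂, hirr, j₂, t₂, hsq₂, hcomm, hCh₂⟩ :=
    modelStep_chain O k θ hθ P q Y hYirr hYcl Ch hChain hStep X σ S hCh hXreg hdom F₉ jG tG hsq T₉ hTS (𝓢 ⊔ K)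
      (vanishingIdeal ⟨Z₉, hZ₉⟩) hCD hCreg hii hiv hDT hTD X₂ τ hτ F₁₀ υ' hυ'
  rw [hsuppZ] at hirr hCh₂
  haveI := hint₂
  haveI := hnoeth₂
  haveI := hF₂
  haveI : IsProper τ := hτ.isProper
  -- the cartesian model square of the step
  have hcart : IsPullback j₂ υ' τ jG := isPullback_of_model_squares θ hθ (σ ≫ q) τ jG tG hsq j₂ t₂
    (by simpa only [Category.assoc] using hsq₂) υ' hcomm
  -- a point of `F₁₀` off the exceptional surface, and `T₁₀ ⊄ E₁₀`
  obtain ⟨t, htT, htZ⟩ := Set.not_subset.mp hTZ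
  obtain ⟨t', ht'⟩ := hυ'.exists_preimage_of_not_mem_support (z := t) (by rw [hsuppZ]; exact htZ)
  have hTE : ¬ closure (υ' ⁻¹' (T₉ \ Z₉)) ⊆ υ' ⁻¹' Z₉ := by
    intro h
    have h1 : t' ∈ closure (υ' ⁻¹' (T₉ \ Z₉)) :=
      subset_closure (show υ' t' ∈ T₉ \ Z₉ by rw [ht']; exact ⟨htT, htZ⟩)
    have h2 : υ' t' ∈ Z₉ := h h1
    rw [ht'] at h2
    exact htZ h2
  have hCne : 𝓢 ⊔ K ≠ ⊥ := by
    rintro hbot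
    obtain ⟨u, hu, hKu⟩ := hτ.isEffectiveCartier.exists_stalkIdeal_eq_span (j₂ t')
    rw [hbot, Scheme.IdealSheafData.comap_bot, stalkIdeal_bot, eq_comm, Ideal.span_singleton_eq_bot] at hKu
    rw [hKu] at hu
    exact zero_notMem_nonZeroDivisors hu
  -- quasi-regular frames of the centre at the special points of `Z₉`
  have hqr : ∀ z ∈ ((⟨Z₉, hZ₉⟩ : Closeds F₉) : Set F₉), ∃ (n : ℕ) (c : Fin n → X.presheaf.stalk (jG z)),
      Ideal.span (Set.range c) = stalkIdeal (𝓢 ⊔ K) (jG z) ∧ IsQuasiRegular c := by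
    intro z hz
    have hzC : jG z ∈ ((𝓢 ⊔ K).support : Set X) := by
      have h1 : z ∈ (((𝓢 ⊔ K).comap jG).support : Set F₉) := by rw [hCD, hsuppZ]; exact hz
      rw [Scheme.IdealSheafData.support_comap] at h1
      exact h1
    haveI : IsRegularLocalRing (X.presheaf.stalk (jG z)) := hXreg (jG z)
    haveI : IsRegularLocalRing (X.presheaf.stalk (jG z) ⧸ stalkIdeal (𝓢 ⊔ K) (jG z)) := hCreg_pt _ hzC (hjsp z)
    obtain ⟨n, c, -, hc, hq, -⟩ := exists_isQuasiRegular_span_eq_of_isRegularLocalRing_quotient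
      (J := stalkIdeal (𝓢 ⊔ K) (jG z)) ((mem_support_iff_stalkIdeal_le _ _).mp hzC) (stalkIdeal (𝓢 ⊔ K) (jG z) : Set _)
      (Ideal.span_eq _)
    exact ⟨n, c, hc, hq⟩
  -- (e-i) exact reduced trace of the new exceptional surface
  have he1 : ((𝓢 ⊔ K).comap τ).comap j₂ = vanishingIdeal ⟨υ' ⁻¹' Z₉, hZ₉.preimage υ'.continuous⟩ :=
    comap_comap_eq_vanishingIdeal_preimage_of_model O k θ hθ (σ ≫ q) jG tG hsq (𝓢 ⊔ K) τ hτ j₂ t₂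
      (by simpa only [Category.assoc] using hsq₂) υ' hcomm ⟨Z₉, hZ₉⟩ hCD hqr
  -- (e-ii) locally principal
  have he2 : ∀ z : X₂, (stalkIdeal ((𝓢 ⊔ K).comap τ) z).IsPrincipal := fun z => by
    obtain ⟨u, -, hu⟩ := hτ.isEffectiveCartier.exists_stalkIdeal_eq_span z
    exact ⟨⟨u, by rw [hu, Ideal.submodule_span_eq]⟩⟩
  -- (e-iii) regular
  have he3 : Scheme.IsRegular ((𝓢 ⊔ K).comap τ).subscheme := hτ.isRegular_subscheme_comap hXreg hCreg
  -- (e-iv) off the generic point of `Y`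
  have he4 : (τ ≫ σ) '' (((𝓢 ⊔ K).comap τ).support : Set X₂) ⊆ {p : P | ¬ IsGenericPoint p Y} := by
    rintro _ ⟨z, hz, rfl⟩
    rw [Scheme.IdealSheafData.support_comap] at hz
    exact hiv ⟨τ z, hz, rfl⟩
  -- the shadow: the curve step is a cone round with `𝓔 := 𝓢` (clause (viii) is its Cartier hypothesis)
  have hk1 : ∀ z : X₂, (stalkIdeal (strictTransformIdeal τ (𝓢 ⊔ K) K) z).IsPrincipal := fun z =>
    isPrincipal_stalkIdeal_strictTransformIdeal hXreg hCreg hτ hCne K (fun z => (hiiip z).2) z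
  have hKc : K₉ = closure K₉ := hKcl.closure_eq.symm
  have hk2 : (strictTransformIdeal τ (𝓢 ⊔ K) K).comap j₂ =
      vanishingIdeal (⟨closure (closure (υ' ⁻¹' (K₉ \ Z₉))), isClosed_closure⟩ : Closeds F₁₀) := by
    have h := coneRound_shadow_comap 𝓢 K hviii hτ hcart ⟨closure K₉, isClosed_closure⟩ ⟨Z₉, hZ₉⟩ hKD hυ'
      (by rw [show ((⟨closure K₉, isClosed_closure⟩ : Closeds F₉) : Set F₉) = K₉ from hKc.symm]; exact hKdense)
    rw [h]
    congr 1
    refine Closeds.ext ?_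
    change closure (υ' ⁻¹' (closure K₉ \ Z₉)) = closure (closure (υ' ⁻¹' (K₉ \ Z₉)))
    rw [closure_closure, ← hKc]
  have hk3 : Flat (((𝓢 ⊔ K).comap τ ⊔ strictTransformIdeal τ (𝓢 ⊔ K) K).subschemeι ≫ (τ ≫ σ) ≫ q) := by
    have h := coneRound_flat 𝓢 K hviii hτ (σ ≫ q) hii
    simpa only [Category.assoc] using h
  have hk4reg : Scheme.IsRegular ((𝓢 ⊔ K).comap τ ⊔ strictTransformIdeal τ (𝓢 ⊔ K) K).subscheme :=
    coneRound_isRegular 𝓢 K hviii hτ hCreg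
  have hk4 : ∀ y : F₁₀, j₂ y ∈ (((𝓢 ⊔ K).comap τ ⊔ strictTransformIdeal τ (𝓢 ⊔ K) K).support : Set X₂) →
      stalkIdeal (vanishingIdeal (⟨υ' ⁻¹' Z₉, hZ₉.preimage υ'.continuous⟩ : Closeds F₁₀) ⊔
        vanishingIdeal (⟨closure (closure (υ' ⁻¹' (K₉ \ Z₉))), isClosed_closure⟩ : Closeds F₁₀)) y =
      stalkIdeal (vanishingIdeal (⟨υ' ⁻¹' Z₉ ∩ closure (closure (υ' ⁻¹' (K₉ \ Z₉))),
        (hZ₉.preimage υ'.continuous).inter isClosed_closure⟩ : Closeds F₁₀)) y →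
      IsRegularLocalRing (X₂.presheaf.stalk (j₂ y) ⧸
        stalkIdeal ((𝓢 ⊔ K).comap τ ⊔ strictTransformIdeal τ (𝓢 ⊔ K) K) (j₂ y)) := by
    intro y hy _
    obtain ⟨s, hs⟩ : j₂ y ∈ Set.range ((𝓢 ⊔ K).comap τ ⊔ strictTransformIdeal τ (𝓢 ⊔ K) K).subschemeι := by
      rw [Scheme.IdealSheafData.range_subschemeι]; exact hy
    have h := (isRegularLocalRing_stalk_subscheme_iff _ s).mp (hk4reg s)
    rw [show ((𝓢 ⊔ K).comap τ ⊔ strictTransformIdeal τ (𝓢 ⊔ K) K).subschemeι.base s = j₂ y from hs] at h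
    exact h
  -- assemble
  refine ⟨hυ', hZinf, hF₂, isClosed_closure, hirr, hZ₉.preimage υ'.continuous, hTE, X₂, τ ≫ σ, _, j₂, t₂, hCh₂, hint₂, hnoeth₂,
    hreg₂, hdom₂, hsq₂, rfl, fun hE => Or.inr ⟨(𝓢 ⊔ K).comap τ, he1, he2, he3, he4, ?_, Or.inr ⟨_, hk1, hk2, hk3, hk4⟩⟩⟩
  exact hRuled X σ S jG tG 𝓢 K X₂ τ j₂ t₂ hCh hXint hXnoeth hXreg hdom hsq hTS hCD hii hCreg hiii hτ hsq₂ hcomm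

set_option maxHeartbeats 800000 in -- one large refine over a 20-clause invariant
/-- **THE CURVE STEP, forgotten-shadow flavour: `TCPlus.Inv ⇒ Tower.Inv₁` with shadow `∅`** (the seed shadow was `∅` — non-conical
`W` or the chain forgot the cone): res-L1-w45b-stub-1's K-free invariant suffices, no cone round is run; modulo the stand-in `hRuled`.
[cite: GortzWedhorn2020, (13.19) and Prop. 13.91] [cite: Liu2002, Thm. 8.1.19] [OURS · L1 W4.5b] clause (curve) of `hsub_reachTower_of_invariant`
/ `hsub_reachTower₁_of_invariant` toward `stub_elnat_coneTowerPointResolution`; NOT a statement of the manuscript. -/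
theorem Tower.inv₁_of_inv_curveStep_forget (O : Type) [CommRing O] [IsDomain O] [IsDiscreteValuationRing O] (k : Type) [Field k]
    (θ : O →+* k) (hθ : Function.Surjective θ)
    (P : Scheme.{0}) (q : P ⟶ Spec (.of O)) [IsProper q] (Y : Set P) (hYirr : IsIrreducible Y) (hYcl : IsClosed Y)
    (hPnoeth : IsLocallyNoetherian P) (hPreg : Scheme.IsRegular P)
    (Ch : ∀ X' : Scheme.{0}, (X' ⟶ P) → Set X' → Prop)
    (hChain : ∀ (X' : Scheme.{0}) (σ : X' ⟶ P) (S : Set X'), Ch X' σ S → Chain P Y X' σ S)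
    (hStep : ∀ (X' X'' : Scheme.{0}) (σ' : X' ⟶ P) (S' : Set X') (C : X'.IdealSheafData) (τ : X'' ⟶ X'),
      Ch X' σ' S' → IsBlowup τ C → Scheme.IsRegular C.subscheme → Flat (C.subschemeι ≫ σ' ≫ q) →
      σ' '' (C.support : Set X') ⊆ {x : P | ¬ IsGenericPoint x Y} →
      (C.support : Set X') ∩ (σ' ≫ q) ⁻¹' {IsLocalRing.closedPoint O} ⊆ S' →
      Ch X'' (τ ≫ σ') (closure (τ ⁻¹' (S' \ (C.support : Set X')))))
    (Ruled : Tower.RuledDatum P)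
    {F₁ F₂ : Scheme.{0}} (W : Set F₁) (F₉ : Scheme.{0}) (β₉ : F₉ ⟶ F₂) (T₉ Z₉ K₉ : Set F₉) (b₉ : Bool) (hZ₉ : IsClosed Z₉)
    (F₁₀ : Scheme.{0}) (υ' : F₁₀ ⟶ F₉)
    (hI : TCPlus.Inv O k θ P q Y Ch W F₉ β₉ T₉ Z₉ b₉) (hZinf : Z₉.Infinite) (hK₉ : K₉ = ∅)
    (hZT : Z₉ ⊆ T₉) (hTZ : ¬ T₉ ⊆ Z₉) (hυ' : IsBlowup υ' (vanishingIdeal ⟨Z₉, hZ₉⟩))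
    -- STAND-IN (owner res-L1-w45b-stub-2 / res-type-027): the ruled-surface datum of the new exceptional surface, root = this step
    (hRuled : ∀ (X : Scheme.{0}) (σ : X ⟶ P) (S : Set X) (jG : F₉ ⟶ X) (tG : F₉ ⟶ Spec (.of k)) (𝓢 K : X.IdealSheafData)
        (X₁₀ : Scheme.{0}) (τ : X₁₀ ⟶ X) (j₁₀ : F₁₀ ⟶ X₁₀) (t₁₀ : F₁₀ ⟶ Spec (.of k)),
        Ch X σ S → IsIntegral X → IsLocallyNoetherian X → Scheme.IsRegular X → IsDominant (σ ≫ q) →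
        IsPullback jG tG (σ ≫ q) (Spec.map (CommRingCat.ofHom θ)) → jG '' T₉ = S →
        (𝓢 ⊔ K).comap jG = vanishingIdeal ⟨Z₉, hZ₉⟩ → Flat ((𝓢 ⊔ K).subschemeι ≫ σ ≫ q) → Scheme.IsRegular (𝓢 ⊔ K).subscheme →
        Scheme.IsRegular 𝓢.subscheme → IsBlowup τ (𝓢 ⊔ K) → IsPullback j₁₀ t₁₀ ((τ ≫ σ) ≫ q) (Spec.map (CommRingCat.ofHom θ)) →
        j₁₀ ≫ τ = υ' ≫ jG →
        Ruled F₉ Z₉ hZ₉ F₁₀ υ' F₁₀ (𝟙 F₁₀) (υ' ⁻¹' Z₉) X₁₀ (τ ≫ σ) j₁₀ ((𝓢 ⊔ K).comap τ)) :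
    Tower.Inv₁ O k θ P q Y Ch Ruled F₉ Z₉ hZ₉ F₁₀ υ' F₁₀ (𝟙 F₁₀) (closure (υ' ⁻¹' (T₉ \ Z₉))) (υ' ⁻¹' Z₉)
      (closure (υ' ⁻¹' (K₉ \ Z₉))) := by
  classical
  obtain ⟨hGint, hT₉cl, hT₉irr, -, hmem, -⟩ := hI
  obtain ⟨X, σ, S, jG, tG, 𝓢, K, hCh, hXint, hXnoeth, hXreg, hdom, hsq, hTS, hi, hii, hiii, hiiip, hiv, hv, -⟩ := hmem
  haveI := hGint
  haveI := hXint
  haveI := hXnoeth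
  -- the closed carrier curve
  have hZcl : (⟨closure Z₉, isClosed_closure⟩ : Closeds F₉) = ⟨Z₉, hZ₉⟩ := Closeds.ext hZ₉.closure_eq
  have hCD : (𝓢 ⊔ K).comap jG = vanishingIdeal ⟨Z₉, hZ₉⟩ := by rw [← hZcl]; exact hi
  -- properness of the stage
  obtain ⟨-, -, hσ⟩ := chain_isRegular P Y X σ S (hChain _ _ _ hCh) hPnoeth hPreg
  haveI := hσ
  haveI : IsProper (σ ≫ q) := inferInstance
  -- the model square: `jG` is a closed immersion onto the special fibre
  haveI : IsClosedImmersion (Spec.map (CommRingCat.ofHom θ)) := IsClosedImmersion.spec_of_surjective _ hθ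
  haveI hjci : IsClosedImmersion jG := MorphismProperty.IsStableUnderBaseChange.of_isPullback hsq.flip inferInstance
  have hjsp : ∀ z : F₉, (σ ≫ q) (jG z) = closedPoint O := fun z => by
    have h1 : jG z ∈ Set.range jG := ⟨z, rfl⟩
    rw [range_eq_preimage_of_isPullback hsq, range_specMap_of_surjective_of_field θ hθ] at h1
    exact h1
  -- the centre `𝒞 = 𝓢 ⊔ K` is regular: regular quotient stalks over the closed point + properness
  have hCreg_pt : ∀ x ∈ ((𝓢 ⊔ K).support : Set X), (σ ≫ q) x = closedPoint O →
      IsRegularLocalRing (X.presheaf.stalk x ⧸ stalkIdeal (𝓢 ⊔ K) x) := fun x hx hqx => (hv x hx hqx (by simp)).1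
  haveI : IsProper ((𝓢 ⊔ K).subschemeι ≫ σ ≫ q) := inferInstance
  have hCreg : Scheme.IsRegular (𝓢 ⊔ K).subscheme :=
    Scheme.isRegular_subscheme_of_forall_over_closedPoint (σ ≫ q) (𝓢 ⊔ K) fun x hx hqx => hCreg_pt x hx hqx
  -- support bookkeeping downstairs
  have hsuppZ : ((vanishingIdeal ⟨Z₉, hZ₉⟩ : F₉.IdealSheafData).support : Set F₉) = Z₉ := Scheme.IdealSheafData.coe_support_vanishingIdeal _
  have hDT : ((vanishingIdeal ⟨Z₉, hZ₉⟩ : F₉.IdealSheafData).support : Set F₉) ⊆ T₉ := by rw [hsuppZ]; exact hZT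
  have hTD : ¬ T₉ ⊆ ((vanishingIdeal ⟨Z₉, hZ₉⟩ : F₉.IdealSheafData).support : Set F₉) := by rw [hsuppZ]; exact hTZ
  -- blow up the centre and run the model step
  obtain ⟨X₂, τ, hτ⟩ := exists_isBlowup X (𝓢 ⊔ K)
  obtain ⟨hint₂, hnoeth₂, hreg₂, hdom₂, hF₂, hirr, j₂, t₂, hsq₂, hcomm, hCh₂⟩ :=
    modelStep_chain O k θ hθ P q Y hYirr hYcl Ch hChain hStep X σ S hCh hXreg hdom F₉ jG tG hsq T₉ hTS (𝓢 ⊔ K)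
      (vanishingIdeal ⟨Z₉, hZ₉⟩) hCD hCreg hii hiv hDT hTD X₂ τ hτ F₁₀ υ' hυ'
  rw [hsuppZ] at hirr hCh₂
  haveI := hint₂
  haveI := hnoeth₂
  haveI := hF₂
  haveI : IsProper τ := hτ.isProper
  -- the cartesian model square of the step
  have hcart : IsPullback j₂ υ' τ jG := isPullback_of_model_squares θ hθ (σ ≫ q) τ jG tG hsq j₂ t₂
    (by simpa only [Category.assoc] using hsq₂) υ' hcomm
  -- a point of `F₁₀` off the exceptional surface, and `T₁₀ ⊄ E₁₀`
  obtain ⟨t, htT, htZ⟩ := Set.not_subset.mp hTZ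
  obtain ⟨t', ht'⟩ := hυ'.exists_preimage_of_not_mem_support (z := t) (by rw [hsuppZ]; exact htZ)
  have hTE : ¬ closure (υ' ⁻¹' (T₉ \ Z₉)) ⊆ υ' ⁻¹' Z₉ := by
    intro h
    have h1 : t' ∈ closure (υ' ⁻¹' (T₉ \ Z₉)) :=
      subset_closure (show υ' t' ∈ T₉ \ Z₉ by rw [ht']; exact ⟨htT, htZ⟩)
    have h2 : υ' t' ∈ Z₉ := h h1
    rw [ht'] at h2
    exact htZ h2
  -- quasi-regular frames of the centre at the special points of `Z₉`
  have hqr : ∀ z ∈ ((⟨Z₉, hZ₉⟩ : Closeds F₉) : Set F₉), ∃ (n : ℕ) (c : Fin n → X.presheaf.stalk (jG z)),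
      Ideal.span (Set.range c) = stalkIdeal (𝓢 ⊔ K) (jG z) ∧ IsQuasiRegular c := by
    intro z hz
    have hzC : jG z ∈ ((𝓢 ⊔ K).support : Set X) := by
      have h1 : z ∈ (((𝓢 ⊔ K).comap jG).support : Set F₉) := by rw [hCD, hsuppZ]; exact hz
      rw [Scheme.IdealSheafData.support_comap] at h1
      exact h1
    haveI : IsRegularLocalRing (X.presheaf.stalk (jG z)) := hXreg (jG z)
    haveI : IsRegularLocalRing (X.presheaf.stalk (jG z) ⧸ stalkIdeal (𝓢 ⊔ K) (jG z)) := hCreg_pt _ hzC (hjsp z)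
    obtain ⟨n, c, -, hc, hq, -⟩ := exists_isQuasiRegular_span_eq_of_isRegularLocalRing_quotient
      (J := stalkIdeal (𝓢 ⊔ K) (jG z)) ((mem_support_iff_stalkIdeal_le _ _).mp hzC) (stalkIdeal (𝓢 ⊔ K) (jG z) : Set _)
      (Ideal.span_eq _)
    exact ⟨n, c, hc, hq⟩
  -- (e-i) exact reduced trace of the new exceptional surface
  have he1 : ((𝓢 ⊔ K).comap τ).comap j₂ = vanishingIdeal ⟨υ' ⁻¹' Z₉, hZ₉.preimage υ'.continuous⟩ :=
    comap_comap_eq_vanishingIdeal_preimage_of_model O k θ hθ (σ ≫ q) jG tG hsq (𝓢 ⊔ K) τ hτ j₂ t₂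
      (by simpa only [Category.assoc] using hsq₂) υ' hcomm ⟨Z₉, hZ₉⟩ hCD hqr
  -- (e-ii) locally principal
  have he2 : ∀ z : X₂, (stalkIdeal ((𝓢 ⊔ K).comap τ) z).IsPrincipal := fun z => by
    obtain ⟨u, -, hu⟩ := hτ.isEffectiveCartier.exists_stalkIdeal_eq_span z
    exact ⟨⟨u, by rw [hu, Ideal.submodule_span_eq]⟩⟩
  -- (e-iii) regular
  have he3 : Scheme.IsRegular ((𝓢 ⊔ K).comap τ).subscheme := hτ.isRegular_subscheme_comap hXreg hCreg
  -- (e-iv) off the generic point of `Y`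
  have he4 : (τ ≫ σ) '' (((𝓢 ⊔ K).comap τ).support : Set X₂) ⊆ {p : P | ¬ IsGenericPoint p Y} := by
    rintro _ ⟨z, hz, rfl⟩
    rw [Scheme.IdealSheafData.support_comap] at hz
    exact hiv ⟨τ z, hz, rfl⟩
  -- assemble
  refine ⟨hυ', hZinf, hF₂, isClosed_closure, hirr, hZ₉.preimage υ'.continuous, hTE, X₂, τ ≫ σ, _, j₂, t₂, hCh₂, hint₂, hnoeth₂,
    hreg₂, hdom₂, hsq₂, rfl, fun hE => Or.inr ⟨(𝓢 ⊔ K).comap τ, he1, he2, he3, he4, ?_, Or.inl (by subst hK₉; simp)⟩⟩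
  exact hRuled X σ S jG tG 𝓢 K X₂ τ j₂ t₂ hCh hXint hXnoeth hXreg hdom hsq hTS hCD hii hCreg hiii hτ hsq₂ hcomm

end Summit.ResolutionOfSingularities.ResolutionOfSingularities.Cruxes.EquisingularLiftNat.Sections

end
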